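import Mathlib
import Literature.Analysis.FluidPDE.Tao2016AveragedNS.ShiftSetCascadeFlows
import Summits.NavierStokesRegularity.NavierStokesRegularity.Theorems.TaoLadderRungTwoFlatMirrorTableDefs
import Summits.NavierStokesRegularity.NavierStokesRegularity.Theorems.TaoLadderRungTwoFlatQuadPolarOn
import Summits.NavierStokesRegularity.NavierStokesRegularity.Theorems.TaoLadderRungTwoFlatPulseDefs
import Summits.NavierStokesRegularity.NavierStokesRegularity.Theorems.TaoLadderRungTwoFlatLinearisedUniqueness
import HarnessLib

/-!
# Gronwall bound for bounded solutions of the linearised homogeneous lattice equation (any shift set)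
  (helper for item stmt-NavierStokesRegularity-22987 `FlatGapCertificatesV2`, crux K_A♭ of route
  TaoLadderRungTwoFlat; cell harvest/h2-tao-ladder, p1 g19)

Continuous dependence for the solution class of (S2) `MirrorPulse.LinearisedHopContraction`: at scale ratio `1`,
along a continuous background bounded by `M_Φ`, a solution of `u̇ = Lin_Φ(u)` that is bounded on `[0, T]` and has
`|u(0)| ≤ B` at every site satisfies the Picard majorants
`|u_{i,n}(s)| ≤ B · Σ_{l<j} (Ls)^l/l! + M_u (Ls)^j/j!` (`abs_le_sum_add_pow_div_factorial`, `L = 2‖α‖₁M_Φ`) and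
hence the GRONWALL BOUND `|u_{i,n}(s)| ≤ B · e^{Ls}` on `[0, T]` (`abs_le_mul_exp`; corollary
`MirrorPulse.isVariationalOn_gronwall`). With `…LinearisedUniqueness` this makes the (S2) class a well-posed one:
unique, and a priori controlled by the data in the sup norm over all sites — the two facts a finite-window
certificate of (S2) rests on.

HONEST FRAMING: elementary real analysis for a MODEL lattice; nothing is certified and nothing is a statement
about the Navier–Stokes equations.
-/

noncomputable section

-- the sub-problem namespace repeats the summit name by design (D-0017)
set_option linter.dupNamespace false

namespace Summit.NavierStokesRegularity.NavierStokesRegularity.Theorems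

open Set Filter Literature.Analysis.FluidPDE Literature.Analysis.FluidPDE.TaoCascade
open scoped Topology Nat

namespace QuadPolar

variable {m : ℕ}

/-- Integral of the Picard majorant: `∫₀ˢ L·(B·Σ_{l<j}(Lσ)^l/l! + M(Lσ)^j/j!) dσ = B·Σ_{l<j}(Ls)^{l+1}/(l+1)! + M(Ls)^{j+1}/(j+1)!`.
[folklore] -/
theorem integral_majorant (L B M s : ℝ) (j : ℕ) :
    ∫ σ in (0 : ℝ)..s, L * (B * ∑ l ∈ Finset.range j, (L * σ) ^ l / l ! + M * (L * σ) ^ j / j !) =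
      B * ∑ l ∈ Finset.range j, (L * s) ^ (l + 1) / (l + 1)! + M * (L * s) ^ (j + 1) / (j + 1)! := by
  have hmono : ∀ (l : ℕ), ∫ σ in (0 : ℝ)..s, (L * σ) ^ l = (L * s) ^ (l + 1) / (L * (l + 1)) ∨ L = 0 := by
    intro l
    by_cases hL : L = 0
    · exact Or.inr hL
    · left
      have e : (fun σ : ℝ => (L * σ) ^ l) = fun σ => L ^ l * σ ^ l := by funext σ; rw [mul_pow]
      rw [e, intervalIntegral.integral_const_mul, integral_pow, zero_pow (Nat.succ_ne_zero l), sub_zero, mul_pow]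
      field_simp
      ring
  by_cases hL : L = 0
  · subst hL
    simp only [zero_mul, intervalIntegral.integral_zero]
    -- right side: every term has a positive power of 0
    simp
  have hint : ∀ l : ℕ, ∫ σ in (0 : ℝ)..s, (L * σ) ^ l = (L * s) ^ (l + 1) / (L * (l + 1)) := fun l =>
    (hmono l).resolve_right hL
  have hI : ∀ l : ℕ, IntervalIntegrable (fun σ : ℝ => (L * σ) ^ l) MeasureTheory.volume 0 s := fun l =>
    ((continuous_const.mul continuous_id).pow l).intervalIntegrable _ _
  -- split the integral
  have e1 : (fun σ : ℝ => L * (B * ∑ l ∈ Finset.range j, (L * σ) ^ l / l ! + M * (L * σ) ^ j / j !)) =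
      fun σ => (∑ l ∈ Finset.range j, (L * B / l !) * (L * σ) ^ l) + (L * M / j !) * (L * σ) ^ j := by
    funext σ
    rw [Finset.mul_sum]
    simp only [mul_add, Finset.mul_sum]
    congr 1
    · refine Finset.sum_congr rfl fun l _ => ?_; ring
    · ring
  rw [e1, intervalIntegral.integral_add, intervalIntegral.integral_finsetSum, intervalIntegral.integral_const_mul,
    hint j]
  · rw [Finset.mul_sum]
    congr 1
    · refine Finset.sum_congr rfl fun l _ => ?_
      rw [intervalIntegral.integral_const_mul, hint l, Nat.factorial_succ]
      push_cast
      field_simp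
    · rw [Nat.factorial_succ]
      push_cast
      field_simp
  · intro l _
    exact (hI l).const_mul _
  · exact (continuous_finsetSum _ fun l _ =>
      continuous_const.mul ((continuous_const.mul continuous_id).pow l)).intervalIntegrable _ _
  · exact (hI j).const_mul _

/-- **The Picard majorants with data.** `|u_{i,n}(s)| ≤ B·Σ_{l<j}(Ls)^l/l! + M_u (Ls)^j/j!` on `[0,T]` for every
`j`, for a solution of `u̇ = Lin_Φ(u)` (scale ratio `1`) bounded by `M_u` on `[0, T]` with `|u(0)| ≤ B`, along a
continuous background bounded by `M_Φ` (`L = 2‖α‖₁M_Φ`). [cite: Tao2016AveragedNS, §4 (4.8); folklore (Picard iteration)] -/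
theorem abs_le_sum_add_pow_div_factorial (𝕊 : Finset (ℤ × ℤ × ℤ))
    (α : Fin m → Fin m → Fin m → ℤ × ℤ × ℤ → ℝ) {Φ u : Fin m → ℤ → ℝ → ℝ} {MΦ Mu B T : ℝ}
    (hΦc : ∀ j k, Continuous (Φ j k)) (hΦ : ∀ j k t, |Φ j k t| ≤ MΦ)
    (hder : ∀ i n t, HasDerivAt (u i n) (linTermOn 𝕊 0 α Φ u i n t) t)
    (hbdd : ∀ i n, ∀ t ∈ Icc 0 T, |u i n t| ≤ Mu) (hB : ∀ i n, |u i n 0| ≤ B) :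
    ∀ (j : ℕ) (i : Fin m) (n : ℤ), ∀ s ∈ Icc 0 T,
      |u i n s| ≤ B * ∑ l ∈ Finset.range j, (2 * tableAbsSum 𝕊 α * MΦ * s) ^ l / l ! +
        Mu * (2 * tableAbsSum 𝕊 α * MΦ * s) ^ j / j ! := by
  set L := 2 * tableAbsSum 𝕊 α * MΦ with hL
  have huc : ∀ j k, Continuous (u j k) := fun j k =>
    continuous_iff_continuousAt.2 fun t => (hder j k t).continuousAt
  have hLc : ∀ i n, Continuous fun t => linTermOn 𝕊 0 α Φ u i n t :=
    fun i n => continuous_linTermOn 𝕊 0 α hΦc huc i n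
  intro j
  induction j with
  | zero =>
    intro i n s hs
    simpa using hbdd i n s hs
  | succ j ih =>
    intro i n s hs
    have hs0 : 0 ≤ s := hs.1
    have hMΦ : 0 ≤ MΦ := (abs_nonneg _).trans (hΦ i n 0)
    have hL0 : 0 ≤ L := by rw [hL]; have := tableAbsSum_nonneg 𝕊 α; positivity
    have hftc : ∫ σ in (0 : ℝ)..s, linTermOn 𝕊 0 α Φ u i n σ = u i n s - u i n 0 :=
      intervalIntegral.integral_eq_sub_of_hasDerivAt (fun σ _ => hder i n σ) ((hLc i n).intervalIntegrable _ _)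
    have hpt : ∀ σ ∈ Icc 0 s, |linTermOn 𝕊 0 α Φ u i n σ| ≤
        L * (B * ∑ l ∈ Finset.range j, (L * σ) ^ l / l ! + Mu * (L * σ) ^ j / j !) := by
      intro σ hσ
      have hσT : σ ∈ Icc 0 T := ⟨hσ.1, hσ.2.trans hs.2⟩
      have hb := abs_linTermOn_zero_le 𝕊 α (fun j' k => hΦ j' k σ) (fun j' k => ih j' k σ hσT) i n
      calc |linTermOn 𝕊 0 α Φ u i n σ|
          ≤ 2 * tableAbsSum 𝕊 α * MΦ *
              (B * ∑ l ∈ Finset.range j, (L * σ) ^ l / l ! + Mu * (L * σ) ^ j / j !) := hb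
        _ = L * (B * ∑ l ∈ Finset.range j, (L * σ) ^ l / l ! + Mu * (L * σ) ^ j / j !) := by rw [hL]
    have hmaj_cont : Continuous fun σ : ℝ =>
        L * (B * ∑ l ∈ Finset.range j, (L * σ) ^ l / l ! + Mu * (L * σ) ^ j / j !) := by
      refine continuous_const.mul (Continuous.add ?_ ?_)
      · exact continuous_const.mul (continuous_finsetSum _ fun l _ =>
          ((continuous_const.mul continuous_id).pow l).div_const _)
      · exact (continuous_const.mul ((continuous_const.mul continuous_id).pow j)).div_const _
    have hu_eq : u i n s = u i n 0 + ∫ σ in (0 : ℝ)..s, linTermOn 𝕊 0 α Φ u i n σ := by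
      rw [hftc]; ring
    calc |u i n s| = |u i n 0 + ∫ σ in (0 : ℝ)..s, linTermOn 𝕊 0 α Φ u i n σ| := by rw [← hu_eq]
      _ ≤ |u i n 0| + |∫ σ in (0 : ℝ)..s, linTermOn 𝕊 0 α Φ u i n σ| := abs_add_le _ _
      _ ≤ B + ∫ σ in (0 : ℝ)..s, |linTermOn 𝕊 0 α Φ u i n σ| :=
          add_le_add (hB i n) (intervalIntegral.abs_integral_le_integral_abs hs0)
      _ ≤ B + ∫ σ in (0 : ℝ)..s, L * (B * ∑ l ∈ Finset.range j, (L * σ) ^ l / l ! + Mu * (L * σ) ^ j / j !) := by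
          gcongr
          exact intervalIntegral.integral_mono_on hs0 (((hLc i n).abs).intervalIntegrable _ _)
            (hmaj_cont.intervalIntegrable _ _) hpt
      _ = B + (B * ∑ l ∈ Finset.range j, (L * s) ^ (l + 1) / (l + 1)! + Mu * (L * s) ^ (j + 1) / (j + 1)!) := by
          rw [integral_majorant]
      _ = B * ∑ l ∈ Finset.range (j + 1), (L * s) ^ l / l ! + Mu * (L * s) ^ (j + 1) / (j + 1)! := by
          rw [Finset.sum_range_succ' (fun l => (L * s) ^ l / (l ! : ℝ))]
          simp only [pow_zero, Nat.factorial_zero, Nat.cast_one, div_one]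
          ring

/-- **GRONWALL BOUND** for bounded solutions of the linearised lattice equation at scale ratio `1`:
`|u_{i,n}(s)| ≤ B · exp(2‖α‖₁ M_Φ s)` on `[0, T]`. [cite: Tao2016AveragedNS, §4 (4.8); folklore (Gronwall)] -/
theorem abs_le_mul_exp (𝕊 : Finset (ℤ × ℤ × ℤ)) (α : Fin m → Fin m → Fin m → ℤ × ℤ × ℤ → ℝ)
    {Φ u : Fin m → ℤ → ℝ → ℝ} {MΦ Mu B T : ℝ} (hΦc : ∀ j k, Continuous (Φ j k))
    (hΦ : ∀ j k t, |Φ j k t| ≤ MΦ) (hder : ∀ i n t, HasDerivAt (u i n) (linTermOn 𝕊 0 α Φ u i n t) t)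
    (hbdd : ∀ i n, ∀ t ∈ Icc 0 T, |u i n t| ≤ Mu) (hB : ∀ i n, |u i n 0| ≤ B) (i : Fin m) (n : ℤ)
    {s : ℝ} (hs : s ∈ Icc 0 T) : |u i n s| ≤ B * Real.exp (2 * tableAbsSum 𝕊 α * MΦ * s) := by
  set x := 2 * tableAbsSum 𝕊 α * MΦ * s with hx
  have hMΦ : 0 ≤ MΦ := (abs_nonneg _).trans (hΦ i n 0)
  have hx0 : 0 ≤ x := by rw [hx]; have := tableAbsSum_nonneg 𝕊 α; have := hs.1; positivity
  have hB0 : 0 ≤ B := (abs_nonneg _).trans (hB i n)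
  have hmaj : ∀ j : ℕ, |u i n s| ≤ B * Real.exp x + Mu * x ^ j / j ! := by
    intro j
    have h := abs_le_sum_add_pow_div_factorial 𝕊 α hΦc hΦ hder hbdd hB j i n s hs
    have hsum : B * ∑ l ∈ Finset.range j, x ^ l / l ! ≤ B * Real.exp x :=
      mul_le_mul_of_nonneg_left (Real.sum_le_exp_of_nonneg hx0 j) hB0
    rw [← hx] at h
    linarith
  have hlim : Tendsto (fun j : ℕ => B * Real.exp x + Mu * x ^ j / j !) atTop (𝓝 (B * Real.exp x)) := by
    have h := (Real.summable_pow_div_factorial x).tendsto_atTop_zero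
    have h2 := (h.const_mul Mu).const_add (B * Real.exp x)
    rw [mul_zero, add_zero] at h2
    refine h2.congr fun j => ?_
    ring
  exact ge_of_tendsto' hlim hmaj

end QuadPolar

namespace MirrorPulse

/-- **A priori control of the (S2) class by its data**: along a bounded global solution `Φ` of the homogeneous
mirror lattice (`|Φ| ≤ M_Φ`), a variational solution bounded on `[0, T]` with `|u(0)| ≤ B` at every site obeys
`|u_{i,n}(s)| ≤ B·exp(2‖T♭‖₁ M_Φ s)` on `[0, T]`. [cite: Tao2016AveragedNS, §4 (4.8); route TaoLadderRungTwoFlat, λ₀ = 1 layer (S2)] -/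
theorem isVariationalOn_gronwall {ε T : ℝ} {Φ u : Fin 2 → ℤ → ℝ → ℝ} {MΦ B : ℝ} (hΦ : IsGlobalSol ε Φ)
    (hM : ∀ j k t, |Φ j k t| ≤ MΦ) (hu : IsVariationalOn ε T Φ u) (hB : ∀ i n, |u i n 0| ≤ B) (i : Fin 2)
    (n : ℤ) {s : ℝ} (hs : s ∈ Icc 0 T) :
    |u i n s| ≤ B * Real.exp (2 * QuadPolar.tableAbsSum shiftSetFlat (mirrorTable ε ε) * MΦ * s) := by
  obtain ⟨hud, Mu, hub⟩ := hu
  have hΦc : ∀ j k, Continuous (Φ j k) := fun j k =>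
    continuous_iff_continuousAt.2 fun t => (hΦ j k t).continuousAt
  exact QuadPolar.abs_le_mul_exp shiftSetFlat (mirrorTable ε ε) hΦc hM hud hub hB i n hs

end MirrorPulse

end Summit.NavierStokesRegularity.NavierStokesRegularity.Theorems

end
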